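import Summits.MatrixMultiplication.MatrixMultiplication.Theses.ConeDesigns

/-!
# `ConeDesigns.RankSixMomentCurve` — cone STPP designs with `N` triangles in `(ZMod q)^6`, `3N ≤ q`

Route `MatrixMultiplication/ConeDesigns`, support item `stmt-MatrixMultiplication-9767`
(`Summit.MatrixMultiplication.MatrixMultiplication.Theses.ConeDesigns.RankSixMomentCurve`):
for every prime `q` and every `N` with `3N ≤ q` there are nonzero vectors
`a i, b i, c i : Fin 6 → ZMod q` (`i < N`) whose punctured lines `F_q^× a i`, `F_q^× b i`,
`F_q^× c i` satisfy the simultaneous triple product property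
`Literature.Computability.AlgebraicComplexity.IsSTPP` (Cohn–Kleinberg–Szegedy–Umans 2005, Def. 5.1,
additive form).

The decl is purely existential, so we use the cheapest witness, the SPLIT design: three families
of pairwise distinct punctured lines placed in three complementary coordinate planes
`F_q^6 = F_q^2 ⊕ F_q^2 ⊕ F_q^2`,
`a i = (1, i, 0, 0, 0, 0)`, `b i = (0, 0, 1, i, 0, 0)`, `c i = (0, 0, 0, 0, 1, i)`.
The STPP equation `(s' - s) + (t' - t) + (u' - u) = 0` with `s' ∈ A i`, `s ∈ A k`, `t ∈ B i`,
`t' ∈ B j`, `u ∈ C j`, `u' ∈ C k` splits coordinatewise into `s' = s`, `t' = t`, `u' = u`, and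
comparing the two nonzero coordinates of each colour gives `i = k`, `j = i`, `k = j`, because
`i ↦ (i : ZMod q)` is injective on `Fin N` (`N ≤ q`).  This is the product of three copies of the
trivial TPP family of disjoint sets (CKSU 2005 §5, Lemma 5.4 flavour); it needs only `N ≤ q` and
gives `N(6,q) ≥ q`, which dominates the normal-rational-curve baseline `⌊q/3⌋` of the item's
docstring (that variant would go through `6 × 6` Vandermonde independence and is not needed for
the decl as stated).  No definitions are introduced: the three witness families are written
inline with `![…]` notation.
-/

-- single-conjunct summit: the mandated namespace `Summit.MatrixMultiplication.MatrixMultiplication.…`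
-- repeats `MatrixMultiplication` (summit = sub-problem), which `linter.dupNamespace` would flag.
set_option linter.dupNamespace false

namespace Summit.MatrixMultiplication.MatrixMultiplication.Theorems

open Literature.Computability.AlgebraicComplexity

/-- Membership in a punctured line: `s ∈ (F_q • v) \ {0}` gives a NONZERO scalar `σ` with
`s = σ • v`. [folklore] -/
theorem coneDesigns_mem_puncturedLine {q n : ℕ} [NeZero q] {v s : Fin n → ZMod q}
    (hs : s ∈ ((Finset.univ : Finset (ZMod q)).image (fun t => t • v)).erase 0) :
    ∃ σ : ZMod q, σ ≠ 0 ∧ s = σ • v := by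
  rw [Finset.mem_erase, Finset.mem_image] at hs
  obtain ⟨hs0, σ, -, rfl⟩ := hs
  refine ⟨σ, ?_, rfl⟩
  rintro rfl
  exact hs0 (zero_smul _ _)

/-- `i ↦ (i : ZMod q)` is injective on `Fin N` when `N ≤ q`. [folklore] -/
theorem coneDesigns_fin_natCast_injective {q N : ℕ} [NeZero q] (hN : N ≤ q) {i k : Fin N}
    (h : ((i : ℕ) : ZMod q) = ((k : ℕ) : ZMod q)) : i = k := by
  apply Fin.ext
  have hi : (i : ℕ) < q := lt_of_lt_of_le i.isLt hN
  have hk : (k : ℕ) < q := lt_of_lt_of_le k.isLt hN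
  have := congrArg ZMod.val h
  rwa [ZMod.val_cast_of_lt hi, ZMod.val_cast_of_lt hk] at this

/-- **The split cone design is STPP.** For a prime `q` and `N ≤ q`, the punctured lines through
`a i = (1, i, 0, 0, 0, 0)`, `b i = (0, 0, 1, i, 0, 0)`, `c i = (0, 0, 0, 0, 1, i)` (`i < N`) form a
simultaneous-triple-product-property family in `(ZMod q)^6`: the defining equation splits over
the three coordinate planes into `s' = s`, `t' = t`, `u' = u`, whence `i = j = k`.
(Product of three trivial TPP families of disjoint sets; cf. Cohn–Kleinberg–Szegedy–Umans 2005,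
§5.) [folklore] -/
theorem coneDesigns_isSTPP_split {q N : ℕ} [Fact q.Prime] (hN : N ≤ q) :
    IsSTPP
      (fun i : Fin N => ((Finset.univ : Finset (ZMod q)).image
        (fun t => t • (![1, ((i : ℕ) : ZMod q), 0, 0, 0, 0] : Fin 6 → ZMod q))).erase 0)
      (fun i : Fin N => ((Finset.univ : Finset (ZMod q)).image
        (fun t => t • (![0, 0, 1, ((i : ℕ) : ZMod q), 0, 0] : Fin 6 → ZMod q))).erase 0)
      (fun i : Fin N => ((Finset.univ : Finset (ZMod q)).image
        (fun t => t • (![0, 0, 0, 0, 1, ((i : ℕ) : ZMod q)] : Fin 6 → ZMod q))).erase 0) := by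
  intro i j k s hs s' hs' t ht t' ht' u hu u' hu' heq
  obtain ⟨σ, hσ, rfl⟩ := coneDesigns_mem_puncturedLine hs
  obtain ⟨σ', -, rfl⟩ := coneDesigns_mem_puncturedLine hs'
  obtain ⟨β, hβ, rfl⟩ := coneDesigns_mem_puncturedLine ht
  obtain ⟨β', -, rfl⟩ := coneDesigns_mem_puncturedLine ht'
  obtain ⟨γ, hγ, rfl⟩ := coneDesigns_mem_puncturedLine hu
  obtain ⟨γ', -, rfl⟩ := coneDesigns_mem_puncturedLine hu'
  have h0 := congr_fun heq 0
  have h1 := congr_fun heq 1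
  have h2 := congr_fun heq 2
  have h3 := congr_fun heq 3
  have h4 := congr_fun heq 4
  have h5 := congr_fun heq 5
  simp only [Pi.add_apply, Pi.sub_apply, Pi.smul_apply, Pi.zero_apply, smul_eq_mul,
    Matrix.cons_val_zero, Matrix.cons_val_one, Matrix.head_cons, Matrix.cons_val_two,
    Matrix.tail_cons, Matrix.cons_val_three, Matrix.cons_val_four, Matrix.cons_val,
    mul_one, mul_zero, add_zero, zero_add, sub_self] at h0 h1 h2 h3 h4 h5
  -- `h0 : σ' - σ = 0`, `h2 : β' - β = 0`, `h4 : γ' - γ = 0`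
  have hσσ : σ' = σ := sub_eq_zero.mp h0
  have hββ : β' = β := sub_eq_zero.mp h2
  have hγγ : γ' = γ := sub_eq_zero.mp h4
  subst hσσ hββ hγγ
  -- `h1 : σ' * i - σ' * k = 0`, `h3 : β' * j - β' * i = 0`, `h5 : γ' * k - γ' * j = 0`
  have hik : i = k := by
    refine coneDesigns_fin_natCast_injective hN (mul_left_cancel₀ hσ ?_)
    exact sub_eq_zero.mp h1
  have hji : j = i := by
    refine coneDesigns_fin_natCast_injective hN (mul_left_cancel₀ hβ ?_)
    exact sub_eq_zero.mp h3
  subst hik hji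
  exact ⟨rfl, rfl, rfl, rfl, rfl⟩

/-- **`RankSixMomentCurve`** (settles `stmt-MatrixMultiplication-9767`, exact route signature
`Summit.MatrixMultiplication.MatrixMultiplication.Theses.ConeDesigns.RankSixMomentCurve`): for
every prime `q` and every `N` with `3N ≤ q` there is a cone STPP design of `N` triangles of nonzero
vectors in `(ZMod q)^6`.  Witness: the split design of `coneDesigns_isSTPP_split` (which needs
only `N ≤ q`); each witness vector has a coordinate equal to `1`, hence is nonzero. [folklore] -/
theorem rankSixMomentCurve_proof :
    Summit.MatrixMultiplication.MatrixMultiplication.Theses.ConeDesigns.RankSixMomentCurve := by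
  unfold Summit.MatrixMultiplication.MatrixMultiplication.Theses.ConeDesigns.RankSixMomentCurve
  intro q _ N hN
  refine ⟨fun i => ![1, ((i : ℕ) : ZMod q), 0, 0, 0, 0],
    fun i => ![0, 0, 1, ((i : ℕ) : ZMod q), 0, 0],
    fun i => ![0, 0, 0, 0, 1, ((i : ℕ) : ZMod q)], fun i => ⟨?_, ?_, ?_⟩,
    coneDesigns_isSTPP_split (le_trans (Nat.le_mul_of_pos_left N (by norm_num)) hN)⟩
  · intro h
    have := congr_fun h 0
    simp at this
  · intro h
    have := congr_fun h 2
    simp at this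
  · intro h
    have := congr_fun h 4
    simp at this

end Summit.MatrixMultiplication.MatrixMultiplication.Theorems
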